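import Literature.AlgebraicGeometry.Motives.HodgeStructureCMHodgeLieSkewCentre
import Literature.AlgebraicGeometry.Motives.HodgeStructureWeilOperator
import Literature.AlgebraicGeometry.Motives.HodgeGroupFlagStabilizerIffCM
import HarnessLib

/-!
# A HODGE ENDOMORPHISM KILLING `Lie Hg(V)` TAKES VALUES IN THE HODGE VECTORS `V ∩ V^{m,m}`; hence the odd-weight results of g40-#3/#4
# hold in EVERY weight for polarizable CM-Hodge structures WITHOUT NON-ZERO HODGE VECTORS (no rational `v` with `1 ⊗ v ∈ V^{m,m}`,
# `2m = n` — e.g. transcendental lattices): a `†`-skew central unit, `2 · dim S₀(H) = dim_ℚ Z(E_φ)`, and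
# `2 · dim Hg(V) = dim_ℚ Z(E_φ) ⟺ Lie Hg(V) = Lie S₀(H)`; in even weight the factors of `Z(E_φ)` with trivial `†` act through Hodge vectors
# (Milne, *Lefschetz classes* §1 p. 645; Green–Griffiths–Kerr Warning p. 154, (V.D.6); Zarhin 1983, K3 surfaces)

[topic AlgebraicGeometry/Motives]

Layer `Literature/AlgebraicGeometry/Motives`, lane `lit-hodgefound` (Track 2 foundations library; seat `lit-hodgefound-p02`, gen 40,
row g40-#5). THEOREMS ONLY: no definition, no named fact (D-0026 net debt `0`), no instance, no notation. Sequel of g40-#3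
`Motives/HodgeStructureCMOddWeightCentreSkewUnit` (odd weight: `Θ` invertible) and g40-#4 `Motives/HodgeStructureCMHodgeLieSkewCentre`
(`Lie S₀(H) = skewSubmodule ψ.adjointEndAlg ⊓ Z(E_φ)`): the hypothesis «odd weight» is replaced by the sharp one — `H` has no non-zero
HODGE VECTOR, `H.hodgeClasses m = ⊥` whenever `2m = n` (the tree's `hodgeClasses`: rational `v` with `1 ⊗ v ∈ F^m`, i.e. `∈ V^{m,m}`) —
which is vacuous in odd weight and holds, in even weight, e.g. for the transcendental part of `H²` of a surface.

## The sources, verbatim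

* M. Green, P. Griffiths, M. Kerr, *Mumford–Tate Groups and Domains* [GreenGriffithsKerr2012], Ch. V, Warning preceding (V.4) p. 154
  (a Hodge structure of type `(p, p)` has trivial Mumford–Tate group and endomorphism algebra all of `End(V)`: the case to exclude);
  (V.D.6) p. 165 («nondegeneracy … Mumford-Tate … is determined solely by which endomorphisms it centralizes»).
* J. S. Milne, *Lefschetz classes on abelian varieties* [Milne1999LefschetzClasses] §1 p. 645: «`C₀(A)` … is a product of fields, each of
  which is either a CM-field or `ℚ`. Every Rosati involution `†` preserves each factor of `C₀(A)` and acts on it as complex conjugation …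
  `S₀(A)(R) = {γ ∈ C₀(A) ⊗_ℚ R | γ†γ = 1}`.»
* Yu. G. Zarhin, *Hodge groups of K3 surfaces*, J. reine angew. Math. **341** (1983) [Zarhin1983], §2 (the transcendental lattice `T` of a
  K3 surface is an irreducible Hodge structure of weight `2` WITHOUT rational `(1,1)`-vectors, `E = End_{Hg} T` is a totally real or
  CM field, and `Hg(T)` is `SO` or the unitary torus `U_E` accordingly); D. Huybrechts, *Lectures on K3 Surfaces* [Huybrechts2016K3]
  §3.3.4 (the Hodge operator lies in `Lie Hg`), Thm. 3.3.9.

## The mechanism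

For `e ∈ E_φ` with `e · Lie Hg(V) = 0`: `e_ℂ Θ = 0` for the Hodge operator `Θ ∈ Lie Hg(V) ⊗ ℂ` (g40-#3), so `e_ℂ` kills every
`V^{p,n−p}` with `2p ≠ n`; writing `1 ⊗ v = Σ_p x_p` (Hodge components, the tree's `pieceProj`), `1 ⊗ e v = e_ℂ(1 ⊗ v) = e_ℂ x_m ∈
V^{m,m}` (`e` is a Hodge endomorphism, `2m = n`), i.e. `e v` is a Hodge vector — and `e = 0` when there are none (or when `n` is odd).
For a CM-Hodge structure and a `†`-fixed central `e` with `†` trivial on `e Z(E_φ)`, `e · Lie Hg(V) = 0` (g40-#3: `(eX)† = eX` and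
`= X† e† = −eX`), so `e` acts through Hodge vectors; with no Hodge vectors `e = 0`, and the algebra of g40-#3 §1 yields the `†`-skew
central unit, whence `2 · dim S₀(H) = dim Z(E_φ)` and the criteria of g40-#2/#4 without their unit condition.

## What is proved

* §1 (any `H`, any weight): `baseChange_comp_eq_zero_of_forall_mul_hodgeLie_eq_zero` (`e · 𝔥 = 0 ⟹ e_ℂ · 𝔥_ℂ = 0`),
  `baseChange_apply_eq_zero_of_mem_piece_of_forall_mul_hodgeLie_eq_zero` (`e_ℂ` kills `V^{p,n−p}`, `2p ≠ n`),
  **`apply_mem_hodgeClasses_of_mem_endAlg_of_forall_mul_hodgeLie_eq_zero`** (`e ∈ E_φ`, `e · Lie Hg(V) = 0`, `2m = n` ⟹ `e v ∈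
  V ∩ V^{m,m}` for all `v`), **`eq_zero_of_mem_endAlg_of_forall_mul_hodgeLie_eq_zero_of_hodgeClasses_eq_bot`** (no Hodge vectors ⟹
  `e = 0`).
* §2 (`ψ : Polarization H`, `hCM : Lie Hg(V) ⊂ E_φ`): `Polarization.mul_hodgeLie_eq_zero_of_center_of_forall_adjoint_eq_self` (a `†`-fixed
  central `e` with `†` trivial on `e Z(E_φ)` kills `Lie Hg(V)`), **`Polarization.apply_mem_hodgeClasses_of_center_of_forall_adjoint_eq_self`**
  (such `e` acts through Hodge vectors: `e v ∈ V ∩ V^{m,m}` — in even weight the `ℚ`/totally-real factors of `C₀` live on the Hodge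
  vectors), and under «no Hodge vectors» (`hT : ∀ m, 2m = n → H.hodgeClasses m = ⊥`): `Polarization.adjoint_ne_self_of_center_of_hodgeClasses_eq_bot`,
  **`Polarization.exists_isUnit_center_adjoint_eq_neg_of_hodgeClasses_eq_bot`** (a `†`-skew central unit),
  **`Polarization.two_mul_finrank_skewSubmodule_inf_center_eq_of_hodgeClasses_eq_bot`** (`2 · dim S₀(H) = dim_ℚ Z(E_φ)`),
  **`Polarization.two_mul_finrank_hodgeLie_eq_finrank_center_endAlg_iff_of_hodgeClasses_eq_bot`** (`2 · dim Hg(V) = dim Z(E_φ) ⟺ Z(E_φ)^{†=−1}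
  ⊆ Lie Hg(V)`), `Polarization.finrank_hodgeLie_eq_finrank_skewSubmodule_inf_center_iff_two_mul_eq_of_hodgeClasses_eq_bot` (`dim Hg = dim S₀
  ⟺ 2 · dim Hg = dim Z`), and the weight-two reading `Polarization.two_mul_finrank_hodgeLie_eq_finrank_center_endAlg_iff_weightTwo`
  (`H.hodgeClasses 1 = ⊥`: transcendental lattices).

## References

* [GreenGriffithsKerr2012] M. Green, P. Griffiths, M. Kerr, *Mumford–Tate Groups and Domains*, Ann. of Math. Stud. 183 (2012): Ch. V Warning
  p. 154, §V.D p. 164, (V.D.6) p. 165.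
* [Milne1999LefschetzClasses] J. S. Milne, *Lefschetz classes on abelian varieties*, Duke Math. J. 96 (1999) 639–675: §1 p. 645, §4 p. 660.
* [Zarhin1983] Yu. G. Zarhin, *Hodge groups of K3 surfaces*, J. reine angew. Math. 341 (1983) 193–220: §2.
* [Huybrechts2016K3] D. Huybrechts, *Lectures on K3 Surfaces*, CUP (2016): §3.3.4 (p. 66), Thm. 3.3.9.
* [DeligneHodgeII1971] P. Deligne, *Théorie de Hodge II*, Publ. Math. IHÉS 40 (1971): 1.2.5 (Hodge decomposition), 2.1.
* [Gordon1999HodgeAVSurvey] B. B. Gordon, *A survey of the Hodge conjecture for abelian varieties* (1999): Thm. 7.5, §7.7.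
-/

noncomputable section

open Module
open scoped TensorProduct
open Literature.RingTheory.CentralSimple (symmSubmodule skewSubmodule mem_symmSubmodule_iff mem_skewSubmodule_iff
  finrank_symmSubmodule_add_finrank_skewSubmodule)

namespace Literature.AlgebraicGeometry.Motives

namespace HodgeStructure

universe u

variable {V : Type u} [AddCommGroup V] [Module ℚ V] [Module.Finite ℚ V] [HodgeTensorFacts.{u, u}] {n : ℤ}
  {H : HodgeStructure V n}

/-! ## §1 A Hodge endomorphism killing `Lie Hg(V)` acts through the Hodge vectors `V ∩ V^{m,m}` -/

variable (H) in
/-- `e · 𝔥 = 0 ⟹ e_ℂ · 𝔥_ℂ = 0` (`𝔥_ℂ` is the `ℂ`-span of the `X_ℂ`, and `e_ℂ X_ℂ = (e X)_ℂ`). [cite: Huybrechts2016K3, §3.3.4 (p. 66)] -/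
theorem baseChange_comp_eq_zero_of_forall_mul_hodgeLie_eq_zero {e : Module.End ℚ V} (he : ∀ X ∈ H.hodgeLie, e * X = 0)
    {Y : Module.End ℂ (ℂ ⊗[ℚ] V)} (hY : Y ∈ H.hodgeLieC) : e.baseChange ℂ ∘ₗ Y = 0 := by
  induction hY using Submodule.span_induction with
  | mem Y hY =>
    obtain ⟨X, hX, rfl⟩ := hY
    rw [← LinearMap.baseChange_comp, ← Module.End.mul_eq_comp, he X hX, LinearMap.baseChange_zero]
  | zero => rw [LinearMap.comp_zero]
  | add Y Z _ _ hY hZ => rw [LinearMap.comp_add, hY, hZ, add_zero]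
  | smul c Y _ hY => rw [LinearMap.comp_smul, hY, smul_zero]

variable (H) in
/-- **`e · 𝔥 = 0 ⟹ e_ℂ` kills every `V^{p,n−p}` with `2p ≠ n`**: the Hodge operator `Θ ∈ 𝔥_ℂ` acts there by the non-zero scalar `2p − n`
and `e_ℂ Θ = 0`. [cite: Huybrechts2016K3, §3.3.4 (p. 66)] [cite: GreenGriffithsKerr2012, Ch. V Warning p. 154] -/
theorem baseChange_apply_eq_zero_of_mem_piece_of_forall_mul_hodgeLie_eq_zero {e : Module.End ℚ V}
    (he : ∀ X ∈ H.hodgeLie, e * X = 0) {p : ℤ} (hp : 2 * p ≠ n) {y : ℂ ⊗[ℚ] V} (hy : y ∈ H.piece p (n - p)) :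
    e.baseChange ℂ y = 0 := by
  obtain ⟨Θ, hΘ⟩ := exists_hodgeTheta H
  have heΘ : e.baseChange ℂ ∘ₗ Θ = 0 :=
    baseChange_comp_eq_zero_of_forall_mul_hodgeLie_eq_zero H he (H.mem_hodgeLieC_of_forall_piece hΘ)
  have hc : ((2 * p - n : ℤ) : ℂ) ≠ 0 := by exact_mod_cast sub_ne_zero.2 hp
  have h1 : e.baseChange ℂ (Θ y) = 0 := by rw [← LinearMap.comp_apply, heΘ, LinearMap.zero_apply]
  rw [hΘ p y hy, map_smul] at h1
  exact (smul_eq_zero.1 h1).resolve_left hc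

variable (H) in
/-- **A HODGE ENDOMORPHISM `e` WITH `e · Lie Hg(V) = 0` TAKES VALUES IN THE HODGE VECTORS**: for `2m = n` and every `v ∈ V`,
`e v ∈ V ∩ V^{m,m}` (the tree's `hodgeClasses m`) — writing `1 ⊗ v = Σ_p x_p` in Hodge components, `e_ℂ` kills the `x_p` with `p ≠ m`
and maps `x_m` into `V^{m,m}`, so `1 ⊗ e v = e_ℂ x_m ∈ V^{m,m}`. (The Mumford–Tate group acts trivially exactly on the type-`(m,m)`
part.) [cite: GreenGriffithsKerr2012, Ch. V Warning p. 154 and (V.D.6) p. 165] [cite: DeligneHodgeII1971, 1.2.5] -/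
theorem apply_mem_hodgeClasses_of_mem_endAlg_of_forall_mul_hodgeLie_eq_zero {e : Module.End ℚ V} (hend : e ∈ H.endAlg)
    (he : ∀ X ∈ H.hodgeLie, e * X = 0) {m : ℤ} (hm : 2 * m = n) (v : V) : e v ∈ H.hodgeClasses m := by
  classical
  have hpres : ∀ p q : ℤ, (H.piece p q).map (e.baseChange ℂ) ≤ H.piece p q :=
    (forall_map_piece_le_baseChange_iff_mem_endAlg (H := H) e).2 hend
  -- decompose `1 ⊗ v` into Hodge components and apply `e_ℂ`
  set x : ℂ ⊗[ℚ] V := ofRat v with hx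
  have hsum : ∑ p ∈ H.pieceSupport x, e.baseChange ℂ (H.pieceProj p x) = e.baseChange ℂ x := by
    rw [← map_sum, sum_pieceProj]
  have hterm : ∀ p ∈ H.pieceSupport x, e.baseChange ℂ (H.pieceProj p x) ∈ H.piece m (n - m) := fun p _ => by
    by_cases hpm : p = m
    · subst hpm
      exact hpres p (n - p) ⟨_, pieceProj_mem H p x, rfl⟩
    · have hp : 2 * p ≠ n := fun h => hpm (by omega)
      rw [baseChange_apply_eq_zero_of_mem_piece_of_forall_mul_hodgeLie_eq_zero H he hp (pieceProj_mem H p x)]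
      exact Submodule.zero_mem _
  have hex : e.baseChange ℂ x ∈ H.piece m (n - m) := by
    rw [← hsum]
    exact Submodule.sum_mem _ hterm
  rw [mem_hodgeClasses_iff]
  have h1 : ofRat (e v) = e.baseChange ℂ x := by
    rw [hx, ofRat_apply, ofRat_apply, LinearMap.baseChange_tmul]
  rw [h1]
  exact piece_le_F H m (n - m) hex

variable (H) in
/-- **NO HODGE VECTORS ⟹ a Hodge endomorphism killing `Lie Hg(V)` vanishes**: if `H.hodgeClasses m = ⊥` whenever `2m = n` (no non-zero
rational vector of type `(m,m)`; vacuous in odd weight) then `e ∈ E_φ` with `e · Lie Hg(V) = 0` is `0` (in odd weight this is g40-#3's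
`eq_zero_of_forall_mul_hodgeLie_eq_zero`, for every `e`). [cite: GreenGriffithsKerr2012, Ch. V Warning p. 154] [cite: Zarhin1983, §2] -/
theorem eq_zero_of_mem_endAlg_of_forall_mul_hodgeLie_eq_zero_of_hodgeClasses_eq_bot {e : Module.End ℚ V} (hend : e ∈ H.endAlg)
    (he : ∀ X ∈ H.hodgeLie, e * X = 0) (hT : ∀ m : ℤ, 2 * m = n → H.hodgeClasses m = ⊥) : e = 0 := by
  rcases Int.even_or_odd n with ⟨m, hm⟩ | hodd
  · have hm' : 2 * m = n := by omega
    refine LinearMap.ext fun v => ?_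
    have hv := apply_mem_hodgeClasses_of_mem_endAlg_of_forall_mul_hodgeLie_eq_zero H hend he hm' v
    rw [hT m hm', Submodule.mem_bot] at hv
    rw [hv, LinearMap.zero_apply]
  · exact eq_zero_of_forall_mul_hodgeLie_eq_zero H hodd he

/-! ## §2 Polarizable CM-Hodge structures: the `†`-trivial part of the centre acts through Hodge vectors; no Hodge vectors ⟹ a
`†`-skew central unit, `2 · dim S₀(H) = dim Z(E_φ)`, and the equality criteria -/

/-- **A `†`-fixed central `e` with `†` trivial on `e Z(E_φ)` kills `Lie Hg(V)`** (CM type: `X ∈ Lie Hg(V)` is central and `†`-skew, so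
`(eX)† = eX` and `(eX)† = X† e† = −eX`). [cite: Milne1999LefschetzClasses, §1 p. 645] [cite: GreenGriffithsKerr2012, (V.D.6) p. 165] -/
theorem Polarization.mul_hodgeLie_eq_zero_of_center_of_forall_adjoint_eq_self (ψ : Polarization H)
    (hCM : H.hodgeLie ≤ Subalgebra.toSubmodule H.endAlg) (e : Subalgebra.center ℚ H.endAlg)
    (heτ : ψ.adjoint ((e : H.endAlg) : Module.End ℚ V) = ((e : H.endAlg) : Module.End ℚ V))
    (hcon : ∀ x : Subalgebra.center ℚ H.endAlg,
      ψ.adjoint (((e * x : Subalgebra.center ℚ H.endAlg) : H.endAlg) : Module.End ℚ V) =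
        ((e * x : Subalgebra.center ℚ H.endAlg) : H.endAlg)) :
    ∀ X ∈ H.hodgeLie, ((e : H.endAlg) : Module.End ℚ V) * X = 0 := fun X hX => by
  let z : Subalgebra.center ℚ H.endAlg := ⟨⟨X, hCM hX⟩, mem_center_endAlg_of_mem_hodgeLie hCM hX⟩
  have hzv : ((z : H.endAlg) : Module.End ℚ V) = X := rfl
  have h1 : ψ.adjoint (((e * z : Subalgebra.center ℚ H.endAlg) : H.endAlg) : Module.End ℚ V) =
      ((e * z : Subalgebra.center ℚ H.endAlg) : H.endAlg) := hcon z
  have hprod : (((e * z : Subalgebra.center ℚ H.endAlg) : H.endAlg) : Module.End ℚ V) =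
      ((e : H.endAlg) : Module.End ℚ V) * X := by
    rw [Subalgebra.coe_mul, Subalgebra.coe_mul, hzv]
  have h2 : ψ.adjoint (((e : H.endAlg) : Module.End ℚ V) * X) = -(((e : H.endAlg) : Module.End ℚ V) * X) := by
    rw [ψ.adjoint_mul, heτ, ψ.adjoint_eq_neg_of_mem_hodgeLie hX, neg_mul]
    have hc := Subalgebra.mem_center_iff.1 e.2 ⟨X, hCM hX⟩
    have hc' : X * ((e : H.endAlg) : Module.End ℚ V) = ((e : H.endAlg) : Module.End ℚ V) * X :=
      congrArg Subtype.val hc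
    rw [hc']
  rw [hprod] at h1
  rw [h1] at h2
  have h3 : (2 : ℚ) • (((e : H.endAlg) : Module.End ℚ V) * X) = 0 := by
    rw [two_smul]
    nth_rw 2 [h2]
    rw [add_neg_cancel]
  exact (smul_eq_zero.1 h3).resolve_left two_ne_zero

/-- **IN EVEN WEIGHT `2m` THE `†`-TRIVIAL PART OF THE CENTRE ACTS THROUGH HODGE VECTORS**: a `†`-fixed central `e` with `†` trivial on
`e Z(E_φ)` (CM type) has `e v ∈ V ∩ V^{m,m}` for every `v` — the factors `ℚ` ∕ totally real of Milne's `C₀`, on which `†` is trivial,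
only see the type-`(m,m)` rational vectors. [cite: Milne1999LefschetzClasses, §1 p. 645 («either a CM-field or ℚ»)] [cite: GreenGriffithsKerr2012, Ch. V Warning p. 154] -/
theorem Polarization.apply_mem_hodgeClasses_of_center_of_forall_adjoint_eq_self (ψ : Polarization H)
    (hCM : H.hodgeLie ≤ Subalgebra.toSubmodule H.endAlg) (e : Subalgebra.center ℚ H.endAlg)
    (heτ : ψ.adjoint ((e : H.endAlg) : Module.End ℚ V) = ((e : H.endAlg) : Module.End ℚ V))
    (hcon : ∀ x : Subalgebra.center ℚ H.endAlg,
      ψ.adjoint (((e * x : Subalgebra.center ℚ H.endAlg) : H.endAlg) : Module.End ℚ V) =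
        ((e * x : Subalgebra.center ℚ H.endAlg) : H.endAlg))
    {m : ℤ} (hm : 2 * m = n) (v : V) : ((e : H.endAlg) : Module.End ℚ V) v ∈ H.hodgeClasses m :=
  apply_mem_hodgeClasses_of_mem_endAlg_of_forall_mul_hodgeLie_eq_zero H (e : H.endAlg).2
    (ψ.mul_hodgeLie_eq_zero_of_center_of_forall_adjoint_eq_self hCM e heτ hcon) hm v

/-- **No Hodge vectors ⟹ `†` moves every factor of `Z(E_φ)`** (CM type): no non-zero `†`-fixed central `e` has `†` trivial on
`e Z(E_φ)` (g40-#3's `Polarization.adjoint_ne_self_of_center_of_odd` with «odd weight» replaced by «`H.hodgeClasses m = ⊥` for `2m = n`»).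
[cite: Milne1999LefschetzClasses, §1 p. 645] [cite: GreenGriffithsKerr2012, §V.C p. 162 and (V.D.6) p. 165] [cite: Zarhin1983, §2] -/
theorem Polarization.adjoint_ne_self_of_center_of_hodgeClasses_eq_bot (ψ : Polarization H)
    (hCM : H.hodgeLie ≤ Subalgebra.toSubmodule H.endAlg) (hT : ∀ m : ℤ, 2 * m = n → H.hodgeClasses m = ⊥)
    (e : Subalgebra.center ℚ H.endAlg) (heτ : ψ.adjoint ((e : H.endAlg) : Module.End ℚ V) = ((e : H.endAlg) : Module.End ℚ V))
    (he0 : e ≠ 0) :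
    ∃ x : Subalgebra.center ℚ H.endAlg,
      ψ.adjoint (((e * x : Subalgebra.center ℚ H.endAlg) : H.endAlg) : Module.End ℚ V) ≠
        ((e * x : Subalgebra.center ℚ H.endAlg) : H.endAlg) := by
  by_contra hcon
  replace hcon : ∀ x : Subalgebra.center ℚ H.endAlg,
      ψ.adjoint (((e * x : Subalgebra.center ℚ H.endAlg) : H.endAlg) : Module.End ℚ V) =
        ((e * x : Subalgebra.center ℚ H.endAlg) : H.endAlg) := fun x => not_not.1 (not_exists.1 hcon x)
  apply he0
  have hE : ((e : H.endAlg) : Module.End ℚ V) = 0 :=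
    eq_zero_of_mem_endAlg_of_forall_mul_hodgeLie_eq_zero_of_hodgeClasses_eq_bot H (e : H.endAlg).2
      (ψ.mul_hodgeLie_eq_zero_of_center_of_forall_adjoint_eq_self hCM e heτ hcon) hT
  exact Subtype.ext (Subtype.ext hE)

/-- **NO HODGE VECTORS ⟹ A `†`-SKEW CENTRAL UNIT** (polarizable CM-Hodge structure with `H.hodgeClasses m = ⊥` for `2m = n` — every weight;
all factors of `Z(E_φ)` are CM fields moved by `†`). [cite: Milne1999LefschetzClasses, §1 p. 645] [cite: GreenGriffithsKerr2012, §V.C p. 162]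
[cite: Zarhin1983, §2 (E a CM field, Hg(T) = U_E)] -/
theorem Polarization.exists_isUnit_center_adjoint_eq_neg_of_hodgeClasses_eq_bot (ψ : Polarization H)
    (hCM : H.hodgeLie ≤ Subalgebra.toSubmodule H.endAlg) (hT : ∀ m : ℤ, 2 * m = n → H.hodgeClasses m = ⊥) :
    ∃ z : Subalgebra.center ℚ H.endAlg, IsUnit z ∧
      ψ.adjoint ((z : H.endAlg) : Module.End ℚ V) = -((z : H.endAlg) : Module.End ℚ V) := by
  haveI : IsReduced (Subalgebra.center ℚ H.endAlg) := ψ.isReduced_center_endAlg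
  haveI : Module.Finite ℚ (Subalgebra.center ℚ H.endAlg) := finite_center_endAlg H
  obtain ⟨τ, hτ, hττ⟩ := ψ.exists_algHom_center_endAlg_eq_adjoint
  obtain ⟨u, hu, hτu⟩ := exists_isUnit_skew_of_forall_idempotent (k := ℚ) (R := Subalgebra.center ℚ H.endAlg) τ hττ
    fun (e : Subalgebra.center ℚ H.endAlg) _ heτ he0 => by
      have heτ' : ψ.adjoint ((e : H.endAlg) : Module.End ℚ V) = ((e : H.endAlg) : Module.End ℚ V) := by
        rw [← hτ e, heτ]
      obtain ⟨x, hx⟩ := ψ.adjoint_ne_self_of_center_of_hodgeClasses_eq_bot hCM hT e heτ' he0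
      exact ⟨x, fun h => hx (by rw [← hτ (e * x), h])⟩
  have hτneg : ∀ z : Subalgebra.center ℚ H.endAlg,
      τ z = -z → ψ.adjoint ((z : H.endAlg) : Module.End ℚ V) = -((z : H.endAlg) : Module.End ℚ V) := fun z h => by
    rw [← hτ z, h, Subalgebra.coe_neg, Subalgebra.coe_neg]
  exact ⟨u, hu, hτneg u hτu⟩

/-- **NO HODGE VECTORS ⟹ `2 · dim S₀(H) = dim_ℚ Z(E_φ)`** (CM type; `Lie S₀(H) = skewSubmodule ψ.adjointEndAlg ⊓ Z(E_φ)` of g40-#4):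
g40-#2's equality criterion for `Lie S₀(H) ↪ Z(E_φ)^{†=−1}` (onto) with the unit just found. [cite: Milne1999LefschetzClasses, §1 p. 645 and Prop. 1.7]
[cite: Gordon1999HodgeAVSurvey, Def. 7.4 (rdim, type (IV), d = 1)] -/
theorem Polarization.two_mul_finrank_skewSubmodule_inf_center_eq_of_hodgeClasses_eq_bot (ψ : Polarization H)
    (hCM : H.hodgeLie ≤ Subalgebra.toSubmodule H.endAlg) (hT : ∀ m : ℤ, 2 * m = n → H.hodgeClasses m = ⊥) :
    2 * finrank ℚ ↥(skewSubmodule ψ.adjointEndAlg ⊓ Subalgebra.toSubmodule (Subalgebra.center ℚ H.endAlg)) =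
      finrank ℚ (Subalgebra.center ℚ H.endAlg) := by
  haveI : IsReduced (Subalgebra.center ℚ H.endAlg) := ψ.isReduced_center_endAlg
  haveI : Module.Finite ℚ (Subalgebra.center ℚ H.endAlg) := finite_center_endAlg H
  obtain ⟨τ, hτ, hττ⟩ := ψ.exists_algHom_center_endAlg_eq_adjoint
  let θ : ↥(skewSubmodule ψ.adjointEndAlg ⊓ Subalgebra.toSubmodule (Subalgebra.center ℚ H.endAlg)) →ₗ[ℚ]
      Subalgebra.center ℚ H.endAlg :=
    { toFun := fun a => ⟨(a : H.endAlg), ((ψ.mem_skewSubmodule_adjointEndAlg_inf_center_iff _).1 a.2).2⟩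
      map_add' := fun a b => Subtype.ext rfl
      map_smul' := fun c a => Subtype.ext rfl }
  have hθ : Function.Injective θ := fun a b h => Subtype.ext (congrArg (fun z : Subalgebra.center ℚ H.endAlg => (z : H.endAlg)) h)
  have hτneg : ∀ z : Subalgebra.center ℚ H.endAlg,
      τ z = -z ↔ ψ.adjoint ((z : H.endAlg) : Module.End ℚ V) = -((z : H.endAlg) : Module.End ℚ V) := fun z => by
    constructor
    · intro h
      rw [← hτ z, h, Subalgebra.coe_neg, Subalgebra.coe_neg]
    · intro h
      have hcoe : Function.Injective fun w : Subalgebra.center ℚ H.endAlg => ((w : H.endAlg) : Module.End ℚ V) :=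
        fun w w' hw => Subtype.ext (Subtype.ext hw)
      apply hcoe
      simp only
      rw [hτ z, h, Subalgebra.coe_neg, Subalgebra.coe_neg]
  have hθτ : ∀ a, τ (θ a) = -θ a := fun a =>
    (hτneg (θ a)).2 ((ψ.mem_skewSubmodule_adjointEndAlg_inf_center_iff _).1 a.2).1
  letI : AddCommGroup ↥(skewSubmodule ψ.adjointEndAlg ⊓ Subalgebra.toSubmodule (Subalgebra.center ℚ H.endAlg)) :=
    Submodule.addCommGroup _
  refine (two_mul_finrank_eq_finrank_iff_of_injective_of_map_eq_neg (k := ℚ) (R := Subalgebra.center ℚ H.endAlg)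
    (M := ↥(skewSubmodule ψ.adjointEndAlg ⊓ Subalgebra.toSubmodule (Subalgebra.center ℚ H.endAlg))) τ hττ θ hθ hθτ).2
    ⟨fun w hw => ?_, ?_⟩
  · have hw' : ψ.adjoint ((w : H.endAlg) : Module.End ℚ V) = -((w : H.endAlg) : Module.End ℚ V) := (hτneg w).1 hw
    exact ⟨⟨(w : H.endAlg), (ψ.mem_skewSubmodule_adjointEndAlg_inf_center_iff _).2 ⟨hw', w.2⟩⟩, Subtype.ext rfl⟩
  · obtain ⟨u, hu, hu'⟩ := ψ.exists_isUnit_center_adjoint_eq_neg_of_hodgeClasses_eq_bot hCM hT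
    exact ⟨u, hu, (hτneg u).2 hu'⟩

/-- **NO HODGE VECTORS: `2 · dim Hg(V) = dim_ℚ Z(E_φ)` iff every `†`-skew central Hodge endomorphism lies in `Lie Hg(V)`** (CM type,
every weight; g40-#2's criterion without its unit condition). [cite: GreenGriffithsKerr2012, §V.D p. 164 and (V.D.6) p. 165]
[cite: Milne1999LefschetzClasses, §1 p. 645 and §4 p. 660] [cite: Zarhin1983, §2] -/
theorem Polarization.two_mul_finrank_hodgeLie_eq_finrank_center_endAlg_iff_of_hodgeClasses_eq_bot (ψ : Polarization H)
    (hCM : H.hodgeLie ≤ Subalgebra.toSubmodule H.endAlg) (hT : ∀ m : ℤ, 2 * m = n → H.hodgeClasses m = ⊥) :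
    2 * finrank ℚ H.hodgeLie = finrank ℚ (Subalgebra.center ℚ H.endAlg) ↔
      ∀ z : Subalgebra.center ℚ H.endAlg,
        ψ.adjoint ((z : H.endAlg) : Module.End ℚ V) = -((z : H.endAlg) : Module.End ℚ V) →
          ((z : H.endAlg) : Module.End ℚ V) ∈ H.hodgeLie := by
  rw [ψ.two_mul_finrank_hodgeLie_eq_finrank_center_endAlg_iff hCM]
  exact ⟨And.left, fun h => ⟨h, ψ.exists_isUnit_center_adjoint_eq_neg_of_hodgeClasses_eq_bot hCM hT⟩⟩

/-- **NO HODGE VECTORS: `dim Hg(V) = dim S₀(H)` iff `2 · dim Hg(V) = dim_ℚ Z(E_φ)`** (CM type, every weight).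
[cite: Gordon1999HodgeAVSurvey, Thm. 7.5 (2) ⟺ (3) and §7.7] [cite: Milne1999LefschetzClasses, §1 p. 645] -/
theorem Polarization.finrank_hodgeLie_eq_finrank_skewSubmodule_inf_center_iff_two_mul_eq_of_hodgeClasses_eq_bot (ψ : Polarization H)
    (hCM : H.hodgeLie ≤ Subalgebra.toSubmodule H.endAlg) (hT : ∀ m : ℤ, 2 * m = n → H.hodgeClasses m = ⊥) :
    finrank ℚ H.hodgeLie = finrank ℚ ↥(skewSubmodule ψ.adjointEndAlg ⊓ Subalgebra.toSubmodule (Subalgebra.center ℚ H.endAlg)) ↔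
      2 * finrank ℚ H.hodgeLie = finrank ℚ (Subalgebra.center ℚ H.endAlg) := by
  rw [← ψ.two_mul_finrank_skewSubmodule_inf_center_eq_of_hodgeClasses_eq_bot hCM hT]
  omega

/-- **WEIGHT TWO WITHOUT RATIONAL `(1,1)`-VECTORS** (e.g. the transcendental part `T` of `H²` of a surface with CM, Zarhin: `E` a CM field,
`Hg(T) = U_E`): for a polarizable CM-Hodge structure of weight `2` with `H.hodgeClasses 1 = ⊥`,
`2 · dim Hg(V) = dim_ℚ Z(E_φ) ⟺ Z(E_φ)^{†=−1} ⊆ Lie Hg(V)`. [cite: Zarhin1983, §2] [cite: Huybrechts2016K3, Thm. 3.3.9] [cite: GreenGriffithsKerr2012, (V.D.6) p. 165] -/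
theorem Polarization.two_mul_finrank_hodgeLie_eq_finrank_center_endAlg_iff_weightTwo {H : HodgeStructure V 2} (ψ : Polarization H)
    (hCM : H.hodgeLie ≤ Subalgebra.toSubmodule H.endAlg) (hT : H.hodgeClasses 1 = ⊥) :
    2 * finrank ℚ H.hodgeLie = finrank ℚ (Subalgebra.center ℚ H.endAlg) ↔
      ∀ z : Subalgebra.center ℚ H.endAlg,
        ψ.adjoint ((z : H.endAlg) : Module.End ℚ V) = -((z : H.endAlg) : Module.End ℚ V) →
          ((z : H.endAlg) : Module.End ℚ V) ∈ H.hodgeLie :=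
  ψ.two_mul_finrank_hodgeLie_eq_finrank_center_endAlg_iff_of_hodgeClasses_eq_bot hCM fun m hm => by
    have hm1 : m = 1 := by omega
    subst hm1
    exact hT

end HodgeStructure

end Literature.AlgebraicGeometry.Motives

end
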